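import Mathlib
import Summits.ValiantsHypothesis.ValiantsHypothesis.Theorems.BarrierLeverPartitionMinorsHitByVPHiddenStatesSecondShellNestedRows

/-!
# Route BarrierLever — item `PartitionMinorsHitByVP` (stmt-ValiantsHypothesis-19717), line `hidden-states`:
# ★★ SECOND-SHELL «NESTED-PATH» CLASSES, INNER BOTTOM — the second CANCELLATION cell

Helper file (`--supports stmt-ValiantsHypothesis-19717`; cell valiant-natproofs, 𝒟-side door (c), registered line
`Cruxes/PartitionMinorsHitByVP/Lines/hidden_states.lean` v8; prover seat val-np-p6 gen 17).  Closes NO item; definition-free.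

Companion of `…SecondShellNested` (memo §4 «three movers»).  Same nested paths `C₁∖A₁ = {y_b,y_p}` (attachment `x₁`),
`C₂∖A₂ = {y_m,y_b,y_p}` (attachments `q₁,q₂`), but now the bottom `y_m` of path 2 is an INERT TOKEN OF SWAP 1 (`y_m ∈ A₁ ∩ C₁`)
and `q₁ ∈ C₁`, `q₂ ∉ C₁`, `x₁ ≠ q₂`.  Then the OTHER cross minor dies: with `Z = (A₁ ∩ C₁) ∖ {y_m}` the start row
`C₁ = Z ∪ {y_m,y_b,y_p}` is, on every column of size `≤ t`, the combination `nested_budget_identity'` of the rows `Z ∪ T`,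
`T ∈ {{b,p},{m,p},{p,q₂},{b,m},{m,x₁},{m,q₂},{p},{b},{m},{x₁},{q₂},∅}`, none equal to `A₂`; so `D_{B−A₂+C₁} ≡ 0` and
`…SecondShellExchange` composes: ★★ `exists_table_secondShell_nested'` (discharges the t = 3 class {012,013;0245,1245}:
y_b,y_p = 4,5, x₁ = 1, y_m = 2, q₁,q₂ = 0,3 — the surviving transfer would need `Z₂ = Z`, excluded by `C₁ ≠ C₂`).

HONEST LABEL: conjecture-column cells (second shell, every `t, h`); 19717 stays OPEN; nothing on crux 14610 or VP ≠ VNP.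
-/

set_option linter.dupNamespace false

namespace Summit.ValiantsHypothesis.ValiantsHypothesis.Theorems.BarrierLever.HiddenStates

open Finset

noncomputable section

namespace SecondShell

open PathTable

/-! ## ★★ The inner-bottom nested cell -/

/-- ★★ **SECOND SHELL, NESTED PATHS WITH INNER BOTTOM, EVERY `t, h`.**  `C₁∖A₁ = {y_b,y_p}`, `A₁∖C₁ = {x₁}`,
`C₂∖A₂ = {y_m,y_b,y_p}`, `A₂∖C₂ = {q₁,q₂}`, with `y_m ∈ C₁`, `q₁ ∈ C₁`, `q₂ ∉ C₁`, `x₁ ≠ q₂`: the class is served. -/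
theorem exists_table_secondShell_nested' (h t : ℕ) (A₁ A₂ C₁ C₂ : Finset (Fin h))
    (hA₁ : A₁.card = t) (hA₂ : A₂.card = t) (hC₁ : C₁.card = t + 1) (hC₂ : C₂.card = t + 1)
    (h₁ : ¬ A₁ ⊆ C₁) (h₂ : ¬ A₂ ⊆ C₂) (hA : A₁ ≠ A₂) (hC : C₁ ≠ C₂)
    {ym yb yp x₁ q₁ q₂ : Fin h}
    (hY₁ : C₁ \ A₁ = {yb, yp}) (hbp : yb ≠ yp) (hX₁ : A₁ \ C₁ = {x₁})
    (hY₂ : C₂ \ A₂ = {ym, yb, yp}) (hmb : ym ≠ yb) (hmp : ym ≠ yp) (hX₂ : A₂ \ C₂ = {q₁, q₂}) (hq : q₁ ≠ q₂)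
    (hm : ym ∈ C₁) (hq₁C₁ : q₁ ∈ C₁) (hq₂C₁ : q₂ ∉ C₁) (nxq₂ : x₁ ≠ q₂)
    {r : ℕ} (u cols : Fin r → Finset (Fin h)) (hu : Function.Injective u)
    (hU : ∀ i, ((u i).card ≤ t ∧ u i ≠ A₁ ∧ u i ≠ A₂) ∨ u i = C₁ ∨ u i = C₂)
    (hcols : ∀ J : Finset (Fin h), J.card ≤ t → ∃ kk, cols kk = J) :
    ∃ tx : Option (Fin h) → Fin h → ℂ,
      (Matrix.of fun i kk : Fin r => ∏ a ∈ u i, (tx none a + ∑ q ∈ cols kk, tx (some q) a)).det ≠ 0 := by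
  classical
  obtain ⟨k₁, j₁, j₁', hk₁, hkj₁, a1, a2, a3, a4⟩ := swap_sizes A₁ C₁ hA₁ hC₁ h₁
  obtain ⟨k₂, j₂, j₂', hk₂, hkj₂, b1, b2, b3, b4⟩ := swap_sizes A₂ C₂ hA₂ hC₂ h₂
  -- sizes: `k₁ = 1`, `k₂ = 2`, `|Z| + 2 = t`
  have hY₁c : (C₁ \ A₁).card = 2 := by rw [hY₁, Finset.card_pair hbp]
  have hY₂c : (C₂ \ A₂).card = 3 := by
    rw [hY₂, Finset.card_insert_of_notMem (by simp [hmb, hmp]), Finset.card_pair hbp]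
  obtain rfl : k₁ = 1 := by omega
  obtain rfl : k₂ = 2 := by omega
  -- membership facts
  have hyb₁ : yb ∈ C₁ \ A₁ := by rw [hY₁]; simp
  have hyp₁ : yp ∈ C₁ \ A₁ := by rw [hY₁]; simp
  have hx₁ : x₁ ∈ A₁ \ C₁ := by rw [hX₁]; simp
  have hym₂ : ym ∈ C₂ \ A₂ := by rw [hY₂]; simp
  have hyb₂ : yb ∈ C₂ \ A₂ := by rw [hY₂]; simp
  have hyp₂ : yp ∈ C₂ \ A₂ := by rw [hY₂]; simp
  have hq₁ : q₁ ∈ A₂ \ C₂ := by rw [hX₂]; simp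
  have hq₂ : q₂ ∈ A₂ \ C₂ := by rw [hX₂]; simp
  obtain ⟨⟨hymC, hymA⟩, ⟨hybC, hybA⟩, ⟨hypC, hypA⟩⟩ :=
    And.intro (Finset.mem_sdiff.1 hym₂) (And.intro (Finset.mem_sdiff.1 hyb₂) (Finset.mem_sdiff.1 hyp₂))
  obtain ⟨⟨-, hq₁C⟩, ⟨-, hq₂C⟩⟩ := And.intro (Finset.mem_sdiff.1 hq₁) (Finset.mem_sdiff.1 hq₂)
  obtain ⟨⟨hybC₁, hybA₁⟩, ⟨hypC₁, hypA₁⟩⟩ := And.intro (Finset.mem_sdiff.1 hyb₁) (Finset.mem_sdiff.1 hyp₁)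
  have hxC₁ : x₁ ∉ C₁ := (Finset.mem_sdiff.1 hx₁).2
  -- `ym, q₁ ∈ A₁ ∩ C₁`
  have hymA₁ : ym ∈ A₁ := by
    by_contra h'
    have : ym ∈ C₁ \ A₁ := Finset.mem_sdiff.2 ⟨hm, h'⟩
    rw [hY₁] at this; simp [hmb, hmp] at this
  have nbq₁ : yb ≠ q₁ := fun h' => hq₁C (h' ▸ hybC)
  have npq₁ : yp ≠ q₁ := fun h' => hq₁C (h' ▸ hypC)
  have hq₁A₁ : q₁ ∈ A₁ := by
    by_contra h'
    have : q₁ ∈ C₁ \ A₁ := Finset.mem_sdiff.2 ⟨hq₁C₁, h'⟩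
    rw [hY₁] at this; simp [nbq₁.symm, npq₁.symm] at this
  set Z : Finset (Fin h) := (A₁ ∩ C₁).erase ym with hZdef
  have hZ₁ : A₁ ∩ C₁ = insert ym Z := (Finset.insert_erase (Finset.mem_inter.2 ⟨hymA₁, hm⟩)).symm
  have hZc : Z.card + 2 = t := by
    have h1 := Finset.card_sdiff_add_card_inter A₁ C₁
    rw [a2, hA₁] at h1
    have h2 := Finset.card_erase_of_mem (Finset.mem_inter.2 ⟨hymA₁, hm⟩ : ym ∈ A₁ ∩ C₁)
    rw [← hZdef] at h2
    have h3 : 0 < (A₁ ∩ C₁).card := Finset.card_pos.2 ⟨ym, Finset.mem_inter.2 ⟨hymA₁, hm⟩⟩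
    omega
  -- distinctness
  have nmx : ym ≠ x₁ := fun h' => hxC₁ (h' ▸ hm)
  have nmq₂ : ym ≠ q₂ := fun h' => hq₂C₁ (h' ▸ hm)
  have nbx : yb ≠ x₁ := fun h' => hxC₁ (h' ▸ hybC₁)
  have nbq₂ : yb ≠ q₂ := fun h' => hq₂C (h' ▸ hybC)
  have npx : yp ≠ x₁ := fun h' => hxC₁ (h' ▸ hypC₁)
  have npq₂ : yp ≠ q₂ := fun h' => hq₂C (h' ▸ hypC)
  have nmq₁ : ym ≠ q₁ := fun h' => hq₁C (h' ▸ hymC)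
  -- (non-)membership in `Z`
  have hmZ : ym ∉ Z := Finset.notMem_erase ym _
  have hbZ : yb ∉ Z := fun h' => hybA₁ (Finset.mem_inter.1 (Finset.mem_of_mem_erase h')).1
  have hpZ : yp ∉ Z := fun h' => hypA₁ (Finset.mem_inter.1 (Finset.mem_of_mem_erase h')).1
  have hxZ : x₁ ∉ Z := fun h' => hxC₁ (Finset.mem_inter.1 (Finset.mem_of_mem_erase h')).2
  have hq₂Z : q₂ ∉ Z := fun h' => hq₂C₁ (Finset.mem_inter.1 (Finset.mem_of_mem_erase h')).2
  have hq₁Z : q₁ ∈ Z := Finset.mem_erase.2 ⟨nmq₁.symm, Finset.mem_inter.2 ⟨hq₁A₁, hq₁C₁⟩⟩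
  -- decomposition `C₁ = {ym,yb,yp} ∪ Z`
  have hC₁eq : C₁ = insert ym (insert yb (insert yp Z)) := by
    have h' : C₁ = insert yb (insert yp (C₁ ∩ A₁)) := eq_insert₂_inter hY₁
    rw [Finset.inter_comm, hZ₁] at h'
    rw [h', Finset.insert_comm yp ym, Finset.insert_comm yb ym]
  -- transports
  obtain ⟨e₁, m1, m2, m3, m4, htop₁, hbot₁, hatt₁, -⟩ := exists_equiv_four_oriented A₁ C₁ hk₁ a1 a2 a3 a4
    hyp₁ hyb₁ hbp.symm hx₁ hx₁ (fun h2 => by omega)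
  obtain ⟨e₂, n1, n2, n3, n4, htop₂, hbot₂, hatt₂, hatt₂'⟩ := exists_equiv_four_oriented A₂ C₂ hk₂ b1 b2 b3 b4
    hyp₂ hym₂ hmp.symm hq₁ hq₂ (fun _ => hq)
  have hatt₂1 : e₂ (Sum.inl (Sum.inr ⟨1, by omega⟩)) = q₂ := hatt₂' (le_refl 2)
  -- the middle of path 2 is `yb`
  have hmid₂ : e₂ (Sum.inl (Sum.inl 1)) = yb := by
    have hmem := n1 1
    rw [hY₂] at hmem
    simp only [Finset.mem_insert, Finset.mem_singleton] at hmem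
    rcases hmem with h' | h' | h'
    · exfalso
      have := e₂.injective (h'.trans hbot₂.symm)
      simp at this
    · exact h'
    · exfalso
      have := e₂.injective (h'.trans htop₂.symm)
      simp [Fin.ext_iff] at this
  let N₁ : Fin h → Fin h → ℂ := fun a q => swapTable' e₁ a q - if q = a then 1 else 0
  let N₂ : Fin h → Fin h → ℂ := fun a q => swapTable' e₂ a q - if q = a then 1 else 0
  have hT10 : tab2 N₁ N₂ ![1, 0] = swapTable' e₁ := by funext a q; simp [tab2, N₁]
  have hT01 : tab2 N₁ N₂ ![0, 1] = swapTable' e₂ := by funext a q; simp [tab2, N₂]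
  -- bookkeeping (verbatim from the immobile-token cell)
  set Ball := Finset.univ.filter fun S : Finset (Fin h) => S.card ≤ t with hBall
  set 𝒰 := insert C₁ (insert C₂ ((Ball.erase A₁).erase A₂)) with h𝒰
  have hBA₁ : A₁ ∈ Ball := Finset.mem_filter.2 ⟨Finset.mem_univ _, by omega⟩
  have hBA₂ : A₂ ∈ Ball := Finset.mem_filter.2 ⟨Finset.mem_univ _, by omega⟩
  have hBC₁ : C₁ ∉ Ball := fun h' => by have := (Finset.mem_filter.1 h').2; omega
  have hBC₂ : C₂ ∉ Ball := fun h' => by have := (Finset.mem_filter.1 h').2; omega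
  have h𝒰card : 𝒰.card = Ball.card := card_secondShell_rows Ball hBA₁ hBA₂ hBC₁ hBC₂ hA hC
  have hUmem : ∀ i, u i ∈ 𝒰 := by
    intro i
    rcases hU i with ⟨hc, hne₁, hne₂⟩ | h' | h'
    · refine Finset.mem_insert_of_mem (Finset.mem_insert_of_mem ?_)
      exact Finset.mem_erase.2 ⟨hne₂, Finset.mem_erase.2 ⟨hne₁, Finset.mem_filter.2 ⟨Finset.mem_univ _, hc⟩⟩⟩
    · rw [h']; exact Finset.mem_insert_self _ _
    · rw [h']; exact Finset.mem_insert_of_mem (Finset.mem_insert_self _ _)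
  obtain ⟨hhit, hcolcard⟩ := rows_cover t 𝒰 h𝒰card u cols hu hUmem hcols
  obtain ⟨i₁, hi₁⟩ := hhit C₁ (Finset.mem_insert_self _ _)
  obtain ⟨i₂, hi₂⟩ := hhit C₂ (Finset.mem_insert_of_mem (Finset.mem_insert_self _ _))
  have hne : i₁ ≠ i₂ := fun h' => hC (by rw [← hi₁, ← hi₂, h'])
  have hball : ∀ R : Finset (Fin h), R.card ≤ t → R ≠ A₁ → R ≠ A₂ → ∃ i, i ≠ i₁ ∧ i ≠ i₂ ∧ u i = R := by
    intro R hR hR₁ hR₂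
    obtain ⟨i, hi⟩ := hhit R (Finset.mem_insert_of_mem (Finset.mem_insert_of_mem
      (Finset.mem_erase.2 ⟨hR₂, Finset.mem_erase.2 ⟨hR₁, Finset.mem_filter.2 ⟨Finset.mem_univ _, hR⟩⟩⟩)))
    refine ⟨i, ?_, ?_, hi⟩ <;> (rintro rfl; first | (rw [hi₁] at hi) | (rw [hi₂] at hi)) <;> (rw [← hi] at hR; omega)
  let b : Fin r → Finset (Fin h) := Function.update (Function.update u i₁ A₁) i₂ A₂
  have hb₁ : b i₁ = A₁ := by simp only [b, Function.update_of_ne hne, Function.update_self]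
  have hb₂ : b i₂ = A₂ := by simp only [b, Function.update_self]
  have hb : ∀ i, i ≠ i₁ → i ≠ i₂ → b i = u i := fun i h1 h2 => by simp only [b, Function.update_of_ne h2, Function.update_of_ne h1]
  have hub : Function.update (Function.update b i₁ C₁) i₂ C₂ = u := by
    funext i
    by_cases h2 : i = i₂
    · subst h2; rw [Function.update_self, hi₂]
    · rw [Function.update_of_ne h2]
      by_cases h1 : i = i₁
      · subst h1; rw [Function.update_self, hi₁]
      · rw [Function.update_of_ne h1, hb i h1 h2]
  have hbval : ∀ i, i ≠ i₁ → i ≠ i₂ → (b i).card ≤ t ∧ b i ≠ A₁ ∧ b i ≠ A₂ := by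
    intro i h1 h2
    rw [hb i h1 h2]
    rcases hU i with h' | h' | h'
    · exact h'
    · exact absurd (hi₁ ▸ h') (fun hh => h1 (hu hh))
    · exact absurd (hi₂ ▸ h') (fun hh => h2 (hu hh))
  have hAu : ∀ i, u i ≠ A₁ ∧ u i ≠ A₂ := by
    intro i
    rcases hU i with ⟨-, hne₁, hne₂⟩ | h' | h'
    · exact ⟨hne₁, hne₂⟩
    · rw [h']; constructor <;> (intro h''; rw [h''] at hC₁; omega)
    · rw [h']; constructor <;> (intro h''; rw [h''] at hC₂; omega)
  have hbinj : Function.Injective b := by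
    refine update_injective _ (update_injective u hu i₁ A₁ fun i => (hAu i).1) i₂ A₂ fun i' => ?_
    by_cases h' : i' = i₁
    · rw [h', Function.update_self]; exact hA
    · rw [Function.update_of_ne h']; exact (hAu i').2
  have hC₁b : ∀ i, b i ≠ C₁ := by
    intro i h'
    by_cases h1 : i = i₁
    · rw [h1, hb₁] at h'; rw [h'] at hA₁; omega
    by_cases h2 : i = i₂
    · rw [h2, hb₂] at h'; rw [h'] at hA₂; omega
    · rw [hb i h1 h2, ← hi₁] at h'; exact h1 (hu h')
  have hC₂b : ∀ i, b i ≠ C₂ := by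
    intro i h'
    by_cases h1 : i = i₁
    · rw [h1, hb₁] at h'; rw [h'] at hA₁; omega
    by_cases h2 : i = i₂
    · rw [h2, hb₂] at h'; rw [h'] at hA₂; omega
    · rw [hb i h1 h2, ← hi₂] at h'; exact h2 (hu h')
  have hF1 : (mat (tab2 N₁ N₂ ![1, 0]) (Function.update b i₁ C₁) cols).det ≠ 0 := by
    rw [hT10]
    refine swapTable'_det_ne_zero hk₁ A₁ C₁ e₁ m1 m2 m3 m4 _ cols (update_injective b hbinj i₁ C₁ hC₁b) ?_
      (by rw [hkj₁]; exact hcols)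
    intro i
    by_cases hi : i = i₁
    · right; rw [hi, Function.update_self]
    · left
      rw [Function.update_of_ne hi]
      by_cases h2 : i = i₂
      · rw [h2, hb₂]; exact ⟨by omega, Ne.symm hA⟩
      · have := hbval i hi h2; exact ⟨by rw [hkj₁]; exact this.1, this.2.1⟩
  have hF2 : (mat (tab2 N₁ N₂ ![0, 1]) (Function.update b i₂ C₂) cols).det ≠ 0 := by
    rw [hT01]
    refine swapTable'_det_ne_zero hk₂ A₂ C₂ e₂ n1 n2 n3 n4 _ cols (update_injective b hbinj i₂ C₂ hC₂b) ?_
      (by rw [hkj₂]; exact hcols)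
    intro i
    by_cases hi : i = i₂
    · right; rw [hi, Function.update_self]
    · left
      rw [Function.update_of_ne hi]
      by_cases h1 : i = i₁
      · rw [h1, hb₁]; exact ⟨by omega, hA⟩
      · have := hbval i h1 hi; exact ⟨by rw [hkj₂]; exact this.1, this.2.2⟩
  -- rows of the cross minor `D_{B − A₂ + C₁}` other than `i₂`
  have key : ∀ S : Finset (Fin h), S.card ≤ t → S ≠ A₂ → ∃ i, i ≠ i₂ ∧ Function.update b i₂ C₁ i = S := by
    intro S hS hS₂
    by_cases hS₁ : S = A₁
    · exact ⟨i₁, hne, by rw [Function.update_of_ne hne, hb₁, hS₁]⟩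
    · obtain ⟨i, hi1, hi2, hi⟩ := hball S hS hS₁ hS₂
      exact ⟨i, hi2, by rw [Function.update_of_ne hi2, hb i hi1 hi2, hi]⟩
  have hins2 : ∀ a a' : Fin h, (insert a (insert a' Z)).card ≤ t := fun a a' => by
    have := Finset.card_insert_le a (insert a' Z); have := Finset.card_insert_le a' Z; omega
  have hins1 : ∀ a : Fin h, (insert a Z).card ≤ t := fun a => by
    have := Finset.card_insert_le a Z; omega
  have hneA₂_of : ∀ (a : Fin h) (S : Finset (Fin h)), a ∉ A₂ → insert a S ≠ A₂ :=
    fun a S ha h' => ha (h' ▸ Finset.mem_insert_self a S)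
  have hneA₂_1 : ∀ a : Fin h, insert a Z ≠ A₂ := fun a h' => by
    have h1 := Finset.card_insert_le a Z; rw [h', hA₂] at h1; omega
  have hneA₂_0 : Z ≠ A₂ := fun h' => by rw [h', hA₂] at hZc; omega
  -- ★ the cancellation: an explicit relation among thirteen rows of the cross minor
  have hZ : ∀ ε, (mat (tab2 N₁ N₂ ε) (Function.update b i₂ C₁) cols).det = 0 := by
    intro ε
    set w : Fin h → Fin h → ℂ := tab2 N₁ N₂ ε with hw
    -- closed forms of the table rows
    have hr1b : ∀ q, swapTable' e₁ yb q = (if q = yb then 1 else 0) + (if q = x₁ then 1 else 0) := by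
      intro q; have := row₁_bot e₁ ⟨0, hk₁⟩ q; rwa [hbot₁, hatt₁] at this
    have hr1p : ∀ q, swapTable' e₁ yp q = (if q = yp then 1 else 0) + (if q = yb then 1 else 0) := by
      intro q; have := row₁_top e₁ q; rwa [htop₁, hbot₁] at this
    have hr2m : ∀ q, swapTable' e₂ ym q =
        (if q = ym then 1 else 0) + (if q = q₁ then 1 else 0) + (if q = q₂ then 1 else 0) := by
      intro q
      have := row₂_bot e₂ ⟨0, hk₂⟩ ⟨1, by omega⟩ (by simp) q
      rwa [hbot₂, hatt₂, hatt₂1] at this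
    have hr2b : ∀ q, swapTable' e₂ yb q = (if q = yb then 1 else 0) + (if q = ym then 1 else 0) := by
      intro q; have := row₂_mid e₂ q; rwa [hmid₂, hbot₂] at this
    have hr2p : ∀ q, swapTable' e₂ yp q = (if q = yp then 1 else 0) + (if q = yb then 1 else 0) := by
      intro q; have := row₂_top e₂ q; rwa [htop₂, hmid₂] at this
    have hr1u : ∀ a, a ∉ C₁ \ A₁ → ∀ q, swapTable' e₁ a q = if q = a then 1 else 0 :=
      fun a ha => row_unit A₁ C₁ e₁ m1 ha
    have hr2u : ∀ a, a ∉ C₂ \ A₂ → ∀ q, swapTable' e₂ a q = if q = a then 1 else 0 :=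
      fun a ha => row_unit A₂ C₂ e₂ n1 ha
    have hm₁ : ym ∉ C₁ \ A₁ := by rw [hY₁]; simp [hmb, hmp]
    -- pointwise table entries
    have hwm : ∀ q, w ym q = (if q = ym then 1 else 0) + ε 1 * ((if q = q₁ then 1 else 0) + (if q = q₂ then 1 else 0)) := by
      intro q; simp only [hw, tab2, N₁, N₂, hr1u ym hm₁ q, hr2m q]; ring
    have hwb : ∀ q, w yb q = (if q = yb then 1 else 0) + ε 0 * (if q = x₁ then 1 else 0) + ε 1 * (if q = ym then 1 else 0) := by
      intro q; simp only [hw, tab2, N₁, N₂, hr1b q, hr2b q]; ring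
    have hwp : ∀ q, w yp q = (if q = yp then 1 else 0) + (ε 0 + ε 1) * (if q = yb then 1 else 0) := by
      intro q; simp only [hw, tab2, N₁, N₂, hr1p q, hr2p q]; ring
    have hwu : ∀ a, a ∉ C₁ \ A₁ → a ∉ C₂ \ A₂ → ∀ q, w a q = if q = a then 1 else 0 := by
      intro a h1 h2 q; simp only [hw, tab2, N₁, N₂, hr1u a h1 q, hr2u a h2 q]; ring
    apply det_mat_eq_zero_of_rel w (Function.update b i₂ C₁) cols i₂
      ![ε 1, ε 1, -(ε 1) ^ 2, ε 0 + ε 1, -(ε 0 * (ε 0 + ε 1)), -((ε 0 + ε 1) * (ε 1) ^ 2),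
        -(ε 1) ^ 2, -((ε 0 + ε 1) * ε 1), -((ε 0 + ε 1) * ε 1), ε 0 * (ε 0 + ε 1) * ε 1,
        (ε 0 + ε 1) * (ε 1) ^ 2 * (1 + 2 * ε 1), (ε 0 + ε 1) * (ε 1) ^ 2]
      ![insert yb (insert yp Z), insert ym (insert yp Z), insert yp (insert q₂ Z), insert yb (insert ym Z),
        insert ym (insert x₁ Z), insert ym (insert q₂ Z), insert yp Z, insert yb Z, insert ym Z, insert x₁ Z,
        insert q₂ Z, Z]
    · intro l
      fin_cases l
      · exact key _ (hins2 yb yp) (hneA₂_of yb _ hybA)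
      · exact key _ (hins2 ym yp) (hneA₂_of ym _ hymA)
      · exact key _ (hins2 yp q₂) (hneA₂_of yp _ hypA)
      · exact key _ (hins2 yb ym) (hneA₂_of yb _ hybA)
      · exact key _ (hins2 ym x₁) (hneA₂_of ym _ hymA)
      · exact key _ (hins2 ym q₂) (hneA₂_of ym _ hymA)
      · exact key _ (hins1 yp) (hneA₂_1 yp)
      · exact key _ (hins1 yb) (hneA₂_1 yb)
      · exact key _ (hins1 ym) (hneA₂_1 ym)
      · exact key _ (hins1 x₁) (hneA₂_1 x₁)
      · exact key _ (hins1 q₂) (hneA₂_1 q₂)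
      · exact key Z (show Z.card ≤ t by omega) hneA₂_0
    · intro kk
      rw [Function.update_self]
      simp only [Fin.sum_univ_succ, Fin.sum_univ_zero, Matrix.cons_val_zero, Matrix.cons_val_succ, add_zero]
      set J := cols kk with hJ
      set Y : Fin h → ℂ := fun a => ∑ q ∈ J, w a q with hY
      set Φ : ℂ := ∏ a ∈ Z, Y a with hΦ
      -- products over the row sets
      have hP2 : ∀ a a' : Fin h, a ≠ a' → a ∉ Z → a' ∉ Z →
          ∏ x ∈ insert a (insert a' Z), Y x = Y a * (Y a' * Φ) := by
        intro a a' h1 h2 h3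
        rw [Finset.prod_insert (by simp only [Finset.mem_insert, not_or]; exact ⟨h1, h2⟩), Finset.prod_insert h3]
      have hP1 : ∀ a : Fin h, a ∉ Z → ∏ x ∈ insert a Z, Y x = Y a * Φ := by
        intro a h2; rw [Finset.prod_insert h2]
      have hP3 : ∏ x ∈ C₁, Y x = Y ym * (Y yb * (Y yp * Φ)) := by
        rw [hC₁eq, Finset.prod_insert (by simp only [Finset.mem_insert, not_or]; exact ⟨hmb, hmp, hmZ⟩),
          Finset.prod_insert (by simp only [Finset.mem_insert, not_or]; exact ⟨hbp, hbZ⟩), Finset.prod_insert hpZ]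
      rw [hP3, hP2 yb yp hbp hbZ hpZ, hP2 ym yp hmp hmZ hpZ, hP2 yp q₂ npq₂ hpZ hq₂Z, hP2 yb ym hmb.symm hbZ hmZ,
        hP2 ym x₁ nmx hmZ hxZ, hP2 ym q₂ nmq₂ hmZ hq₂Z, hP1 yp hpZ, hP1 yb hbZ, hP1 ym hmZ, hP1 x₁ hxZ, hP1 q₂ hq₂Z]
      -- the indicators
      set nm : ℕ := if ym ∈ J then 1 else 0 with hnm
      set nb : ℕ := if yb ∈ J then 1 else 0 with hnb
      set np : ℕ := if yp ∈ J then 1 else 0 with hnp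
      set nx : ℕ := if x₁ ∈ J then 1 else 0 with hnx
      set nu : ℕ := if q₁ ∈ J then 1 else 0 with hnu
      set nv : ℕ := if q₂ ∈ J then 1 else 0 with hnv
      have hI : ∀ (a : Fin h), (∑ q ∈ J, (if q = a then (1 : ℂ) else 0)) = ((if a ∈ J then 1 else 0 : ℕ) : ℂ) := by
        intro a; rw [Finset.sum_ite_eq']; split_ifs <;> simp
      have hYm : Y ym = (nm : ℂ) + ε 1 * ((nu : ℂ) + (nv : ℂ)) := by
        simp only [hY, hnm, hnu, hnv]
        rw [Finset.sum_congr rfl (fun q _ => hwm q), Finset.sum_add_distrib, ← Finset.mul_sum,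
          Finset.sum_add_distrib, hI, hI, hI]
      have hYb : Y yb = (nb : ℂ) + ε 0 * (nx : ℂ) + ε 1 * (nm : ℂ) := by
        simp only [hY, hnb, hnx, hnm]
        rw [Finset.sum_congr rfl (fun q _ => hwb q), Finset.sum_add_distrib, Finset.sum_add_distrib,
          ← Finset.mul_sum, ← Finset.mul_sum, hI, hI, hI]
      have hYp : Y yp = (np : ℂ) + (ε 0 + ε 1) * (nb : ℂ) := by
        simp only [hY, hnp, hnb]
        rw [Finset.sum_congr rfl (fun q _ => hwp q), Finset.sum_add_distrib, ← Finset.mul_sum, hI, hI]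
      have hYu : ∀ a, a ∉ C₁ \ A₁ → a ∉ C₂ \ A₂ → Y a = ((if a ∈ J then 1 else 0 : ℕ) : ℂ) := by
        intro a h1 h2
        simp only [hY]
        rw [Finset.sum_congr rfl (fun q _ => hwu a h1 h2 q), hI]
      have hx' : x₁ ∉ C₁ \ A₁ := fun h' => hxC₁ (Finset.mem_sdiff.1 h').1
      have hx'' : x₁ ∉ C₂ \ A₂ := by rw [hY₂]; simp [nmx.symm, nbx.symm, npx.symm]
      have hq₂' : q₂ ∉ C₁ \ A₁ := fun h' => hq₂C₁ (Finset.mem_sdiff.1 h').1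
      have hq₂'' : q₂ ∉ C₂ \ A₂ := fun h' => hq₂C (Finset.mem_sdiff.1 h').1
      have hYx : Y x₁ = (nx : ℂ) := by rw [hYu x₁ hx' hx'', hnx]
      have hYq₂ : Y q₂ = (nv : ℂ) := by rw [hYu q₂ hq₂' hq₂'', hnv]
      rw [hYx, hYq₂]
      -- trivial if some inert token of `Z` is outside `J`
      rcases eq_or_ne Φ 0 with h0 | h0
      · rw [h0]; ring
      -- otherwise `Z ⊆ J` (in particular `q₁ ∈ J`), so at most two of the five free nodes are in `J`
      have hZu : ∀ a ∈ Z, a ∉ C₁ \ A₁ ∧ a ∉ C₂ \ A₂ := by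
        intro a ha
        have ha' := Finset.mem_inter.1 (Finset.mem_of_mem_erase ha)
        refine ⟨fun h' => (Finset.mem_sdiff.1 h').2 ha'.1, ?_⟩
        rw [hY₂]; simp only [Finset.mem_insert, Finset.mem_singleton, not_or]
        refine ⟨Finset.ne_of_mem_erase ha, ?_, ?_⟩
        · rintro rfl; exact hbZ ha
        · rintro rfl; exact hpZ ha
      have hZJ : Z ⊆ J := by
        intro a ha
        by_contra haJ
        apply h0
        apply Finset.prod_eq_zero ha
        rw [hYu a (hZu a ha).1 (hZu a ha).2, if_neg haJ, Nat.cast_zero]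
      have hnu1 : nu = 1 := by simp only [hnu]; exact if_pos (hZJ hq₁Z)
      have hYm' : Y ym = (nm : ℂ) + ε 1 * (1 + (nv : ℂ)) := by rw [hYm, hnu1, Nat.cast_one]
      have hle : nm + nb + np + nx + nv ≤ 2 := by
        have hsub : (({ym, yb, yp, x₁, q₂} : Finset (Fin h)).filter (· ∈ J)) ⊆ J \ Z := by
          intro a ha
          rw [Finset.mem_filter] at ha
          simp only [Finset.mem_insert, Finset.mem_singleton] at ha
          refine Finset.mem_sdiff.2 ⟨ha.2, ?_⟩
          rcases ha.1 with rfl | rfl | rfl | rfl | rfl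
          · exact hmZ
          · exact hbZ
          · exact hpZ
          · exact hxZ
          · exact hq₂Z
        have hcard := Finset.card_le_card hsub
        rw [Finset.card_sdiff_of_subset hZJ, Finset.card_filter] at hcard
        rw [Finset.sum_insert (by simp [hmb, hmp, nmx, nmq₂]), Finset.sum_insert (by simp [hbp, nbx, nbq₂]),
          Finset.sum_insert (by simp [npx, npq₂]), Finset.sum_pair nxq₂] at hcard
        have hJc : J.card ≤ t := hcolcard kk
        simp only [hnm, hnb, hnp, hnx, hnv]
        omega
      have h01 : ∀ (P : Prop) [Decidable P], (if P then 1 else 0 : ℕ) = 0 ∨ (if P then 1 else 0 : ℕ) = 1 := by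
        intro P _; by_cases hP : P
        · exact Or.inr (if_pos hP)
        · exact Or.inl (if_neg hP)
      have hid := nested_budget_identity' (ε 0) (ε 1) nm nb np nx nv (h01 _) (h01 _) (h01 _) (h01 _) (h01 _)
        hle (Y ym) (Y yb) (Y yp) hYm' hYb hYp
      linear_combination Φ * hid
  obtain ⟨tx, htx⟩ := exists_table_of_cross_zero N₁ N₂ b cols hne C₁ C₂ hF1 hF2 (Or.inr hZ)
  exact ⟨tx, by rw [hub] at htx; exact htx⟩

end SecondShell

end

end Summit.ValiantsHypothesis.ValiantsHypothesis.Theorems.BarrierLever.HiddenStates
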